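import Summits.QuantumFields.YangMills.Theorems.IR.AfPincerUcTypChainDeepScreening
import HarnessLib

/-!
# Crux `IR` (stmt-QuantumFields-19354), line `af-pincer-Uc-sharp`: zero-temperature SCREENING IS CELL-LOCAL — restrictions of ground
# states are ground states; (Z) for single cells gives (Z) for every region; the zero-temperature energy budget (seat ym-19354-afpincer-s1 g4)

Helper module for item `stmt-QuantumFields-19354` (`--supports … --as helper`; closes nothing; registry and slot of record «sharp merge
I♯_SC» `Cruxes/IR/Lines/af_pincer_Uc_sharp.lean` sha16 `28967a1bf60ad397` UNTOUCHED; open stub `stub_onsetSharpSC`).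

WHY.  `AfPincerUcTypChainDeepScreening` (this seat, p564192) split the (ii)-side content of the deep lane-A targets into (Z) zero-temperature
screening, (R) rate, (U) uniformity over regions `F'` and meshes, and proved: (Z) for the deep plaquettes of a FIXED region `F'` under all
exteriors ⇒ the `F'`-slices of `KernelPlaqSparseDeep` (every base) and of clause (ii) for `TypChainDeep` (every budget), eventually in `β`.
THIS FILE removes the region from (Z): the zero-temperature hypothesis that feeds every `F'`-slice is a SINGLE-CELL statement.

## What is PROVED here (no `sorry`; axioms ⊆ {propext, Classical.choice, Quot.sound})
* §1 locality of DIFFERENCES of the boundary Wilson action under enlarging the region (`wilsonBoundaryAction_sub_eq_of_subset`: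
  `Λ ⊆ Λ'`, configurations agreeing off `Λ` ⇒ `S_{Λ'}(U) − S_{Λ'}(V) = S_Λ(U) − S_Λ(V)`; `plaquettesTouching_mono`).
* §2 **restrictions of ground states are ground states** (`isGroundState_restrict`): a minimiser of the interior energy of `Λ' ⊇ Λ` at
  exterior `ζ`, restricted to `Λ`, minimises the interior energy of `Λ` at the exterior given by its own glued configuration.
* §3 hence **(Z) is cell-local**: screening of a plaquette family in the SUBREGION `Λ ⊆ Λ'` under ALL exteriors ⇒ screening of that family
  in `Λ'` under all exteriors (`groundStatesScreened_of_subregion`); screening of `deepPlaqs w D c` in the single cell `c` under all exteriors,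
  for every `c ∈ F'` ⇒ screening of `⋃_{c ∈ F'} deepPlaqs w D c` in `regionEdges w F'` (`groundStatesScreened_region_of_cells`); composed with
  p564192: **single-cell (Z) for the cells of `F'` ⇒ the `F'`-slice of `KernelPlaqSparseDeep` for every base `q ∈ (0, 1]`
  (`kernelPlaqSparseDeepOn_of_cellsScreened`) and the `F'`-slice of clause (ii) for `TypChainDeep` for every budget `δ > 0`
  (`clauseIIukpOn_typChainDeep_of_cellsScreened`), eventually in `β`** — so AT ZERO TEMPERATURE nothing of (U) remains: what is uniform
  or not in the region and the mesh is `β₀`, i.e. (R)∕(U) are purely thermal.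
* §4 the zero-temperature ENERGY BUDGET (unitary `ρ`): a ground state's interior energy is at most the flat-interior energy
  `≤ 2N · #{straddling plaquettes}` (`interiorEnergy_le_of_isGroundState`), so its own action is at most that
  (`sum_own_plaqAction_le_of_isGroundState`) and, by a Markov count, the number of own plaquettes of action `≥ θ'` in ANY ground state under
  ANY exterior is `≤ 2N · #straddling / θ'` (`card_bad_own_mul_le_of_isGroundState`) — a boundary-size budget (`O(b³)` of the `Θ(b⁴)` own
  plaquettes of a mesh-`b` cell): forcing (`GroundStatesForce`, `GroundStatesChained[Deep]`) can never fill a core, and (Z) can fail in a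
  given ground state on at most that many plaquettes.  (`cellPlaqs_subset_filter`: the cell's `cellPlaqs` are own plaquettes in this sense.)

## What is NOT proved
(Z) itself for any cell (the located variational question: do Wilson-action minimisers with arbitrary frozen exterior screen their
depth-`D` core? — numerically `≤ 0.03` of the exterior level at `D = 2` in both cooling probes of record; a discrete interior-regularity
statement for lattice Yang–Mills minimisers, for which this seat's presearch found no source), the rate (R), the thermal uniformity (U),
clause (i).  HONEST FRAMING: zero-temperature bookkeeping around ONE open stub of a CONDITIONAL chain (Track A 0/28 UV); nothing of
weak-coupling mixing, asymptotic freedom or a mass gap; not infinite volume, not Clay.  No instances, no notation.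
-/

set_option autoImplicit false

noncomputable section

open MeasureTheory Filter Topology
open Literature.MathematicalPhysics.QuantumFieldTheory hiding ZdEdge
open Literature.MathematicalPhysics.QuantumLattice
open Literature.Probability.LatticeModels
open Summit.QuantumFields.YangMills.Cruxes.IR.Tempered (cellEdges regionEdges)
open Summit.QuantumFields.YangMills.Theorems.OddTorusChessboard (cellPlaqs plaqAction plaqAction_congr plaqAction_one
  plaqAction_le_two_mul measurable_plaqAction plaquetteEdges_subset_of_mem_cellPlaqs)
open Summit.QuantumFields.YangMills.Theorems.IRTypLocalExcess (plaqAction_nonneg)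

namespace Summit.QuantumFields.YangMills.Cruxes.IR.AfPincerUc.SharpLanes.GroundStateLocality

open Summit.QuantumFields.YangMills.Cruxes.IR.AfPincerUc
open Summit.QuantumFields.YangMills.Cruxes.IR.AfPincerUc.SharpLanes
open Summit.QuantumFields.YangMills.Cruxes.IR.AfPincerUc.SharpLanes.GroundStateForcing
open Summit.QuantumFields.YangMills.Cruxes.IR.AfPincerUc.SharpLanes.GroundStateScreening

/-! ## §1 Locality of the boundary Wilson action under enlarging the region -/
section Locality

variable {G : Type} [Group G] {N : ℕ} (ρ : G →* Matrix (Fin N) (Fin N) ℂ)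

omit [Group G] in
/-- `plaquettesTouching` is monotone in the edge set. -/
theorem plaquettesTouching_mono {Λ Λ' : Finset (ZdEdge 4)} (h : Λ ⊆ Λ') : plaquettesTouching Λ ⊆ plaquettesTouching Λ' := by
  intro p hp
  rw [mem_plaquettesTouching_iff] at hp ⊢
  obtain ⟨e, he⟩ := hp
  exact ⟨e, Finset.mem_inter.2 ⟨(Finset.mem_inter.1 he).1, h (Finset.mem_inter.1 he).2⟩⟩

/-- The boundary Wilson action is the sum of the plaquette actions `s_p = N − Re tr ρ(U_p)` over the plaquettes touching `Λ`. -/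
theorem wilsonBoundaryAction_eq_sum_plaqAction (Λ : Finset (ZdEdge 4)) (U : LGConfig 4 G) :
    wilsonBoundaryAction ρ Λ U = ∑ p ∈ plaquettesTouching Λ, plaqAction ρ p U := rfl

/-- **Locality of action DIFFERENCES (PROVED):** for `Λ ⊆ Λ'` and two configurations agreeing OFF `Λ`, the difference of the
boundary Wilson actions of `Λ'` equals that of `Λ` (plaquettes touching `Λ'` but not `Λ` see the same links). -/
theorem wilsonBoundaryAction_sub_eq_of_subset {Λ Λ' : Finset (ZdEdge 4)} (hΛ : Λ ⊆ Λ') {U V : LGConfig 4 G}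
    (hUV : ∀ e ∉ Λ, U e = V e) :
    wilsonBoundaryAction ρ Λ' U - wilsonBoundaryAction ρ Λ' V =
      wilsonBoundaryAction ρ Λ U - wilsonBoundaryAction ρ Λ V := by
  classical
  simp only [wilsonBoundaryAction_eq_sum_plaqAction]
  have hA : ∑ p ∈ plaquettesTouching Λ' \ plaquettesTouching Λ, plaqAction ρ p U =
      ∑ p ∈ plaquettesTouching Λ' \ plaquettesTouching Λ, plaqAction ρ p V :=
    Finset.sum_congr rfl fun p hp => by
      unfold plaqAction
      rw [plaquetteObs_eq_of_not_mem_plaquettesTouching ρ p hUV (Finset.mem_sdiff.1 hp).2]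
  rw [← Finset.sum_sdiff (plaquettesTouching_mono hΛ) (f := fun p => plaqAction ρ p U),
    ← Finset.sum_sdiff (plaquettesTouching_mono hΛ) (f := fun p => plaqAction ρ p V), hA]
  ring

end Locality

/-! ## §2 Restrictions of ground states are ground states -/
section Restrict

variable {G : Type} [Group G] {N : ℕ} (ρ : G →* Matrix (Fin N) (Fin N) ℂ)

omit [Group G] in
/-- Gluing a configuration's own values into itself changes nothing. -/
theorem glueWith_restrict_self (Λ : Finset (ZdEdge 4)) (U : LGConfig 4 G) :
    glueWith Λ (fun e : ↥Λ => U e) U = U := by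
  funext e
  by_cases he : e ∈ Λ
  · rw [glueWith_apply_mem _ _ _ he]
  · rw [glueWith_apply_not_mem _ _ _ he]

/-- **Restriction of a ground state is a ground state (PROVED).**  If `x'` minimises the interior energy of `Λ'` at exterior `ζ`
and `Λ ⊆ Λ'`, then the restriction of the glued configuration `U = x' ζ_{Λ'ᶜ}` to `Λ` minimises the interior energy of `Λ` at
exterior `U` (the other links of `Λ'` now frozen at their ground-state values): a better competitor on `Λ` would, glued into
`U`, improve `x'` by the locality of action differences. -/
theorem isGroundState_restrict {Λ Λ' : Finset (ZdEdge 4)} (hΛ : Λ ⊆ Λ') {ζ : LGConfig 4 G} {x' : ↥Λ' → G}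
    (hx' : IsGroundState ρ Λ' ζ x') :
    IsGroundState ρ Λ (glueWith Λ' x' ζ) (fun e : ↥Λ => glueWith Λ' x' ζ e) := by
  intro y
  have hVU : ∀ e ∉ Λ, glueWith Λ y (glueWith Λ' x' ζ) e = glueWith Λ' x' ζ e := fun e he =>
    glueWith_apply_not_mem _ _ _ he
  have hV' : glueWith Λ' (fun e : ↥Λ' => glueWith Λ y (glueWith Λ' x' ζ) e) ζ = glueWith Λ y (glueWith Λ' x' ζ) := by
    funext e
    by_cases he : e ∈ Λ'
    · rw [glueWith_apply_mem _ _ _ he]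
    · rw [glueWith_apply_not_mem _ _ _ he, hVU e (fun h => he (hΛ h)), glueWith_apply_not_mem _ _ _ he]
  have hmin := hx' (fun e : ↥Λ' => glueWith Λ y (glueWith Λ' x' ζ) e)
  unfold interiorEnergy at hmin ⊢
  rw [hV'] at hmin
  rw [glueWith_restrict_self]
  have hloc := wilsonBoundaryAction_sub_eq_of_subset ρ hΛ hVU
  linarith

end Restrict

/-! ## §3 (Z) is cell-local -/
section CellLocal

variable {G : Type} [Group G] [TopologicalSpace G] [IsTopologicalGroup G] [CompactSpace G]
  [MeasurableSpace G] [BorelSpace G] [SecondCountableTopology G] {N : ℕ} (ρ : G →* Matrix (Fin N) (Fin N) ℂ)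

omit [TopologicalSpace G] [IsTopologicalGroup G] [CompactSpace G] [MeasurableSpace G] [BorelSpace G] [SecondCountableTopology G] in
/-- **Screening passes from a subregion to the region (PROVED):** if the ground states of `Λ ⊆ Λ'` screen the family `Pl` under EVERY
exterior, then the ground states of `Λ'` screen `Pl` under every exterior (restrict the ground state to `Λ`, §2). -/
theorem groundStatesScreened_of_subregion {θ m : ℝ} {Λ Λ' : Finset (ZdEdge 4)} (hΛ : Λ ⊆ Λ') {Pl : Finset (ZdPlaquette 4)}
    (h : ∀ η : LGConfig 4 G, GroundStatesScreened ρ θ m Λ Pl η) (ζ : LGConfig 4 G) :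
    GroundStatesScreened ρ θ m Λ' Pl ζ := by
  intro x' hx' p hp
  have h1 := h (glueWith Λ' x' ζ) _ (isGroundState_restrict ρ hΛ hx') p hp
  rwa [glueWith_restrict_self] at h1

omit [TopologicalSpace G] [IsTopologicalGroup G] [CompactSpace G] [MeasurableSpace G] [BorelSpace G] [SecondCountableTopology G] in
/-- Screening of a finite union of families is screening of each. -/
theorem groundStatesScreened_biUnion {θ m : ℝ} {Λ : Finset (ZdEdge 4)} {ι : Type} [DecidableEq (ZdPlaquette 4)] (s : Finset ι)
    (P : ι → Finset (ZdPlaquette 4)) {ζ : LGConfig 4 G} (h : ∀ i ∈ s, GroundStatesScreened ρ θ m Λ (P i) ζ) :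
    GroundStatesScreened ρ θ m Λ (s.biUnion P) ζ := by
  intro x hx p hp
  obtain ⟨i, hi, hpi⟩ := Finset.mem_biUnion.1 hp
  exact h i hi x hx p hpi

omit [TopologicalSpace G] [IsTopologicalGroup G] [CompactSpace G] [MeasurableSpace G] [BorelSpace G] [SecondCountableTopology G] in
/-- **(Z) IS CELL-LOCAL (PROVED):** if for every cell `c ∈ F'` the ground states of the SINGLE CELL `c` (region `regionEdges w {c}`) screen
its deep plaquettes `deepPlaqs w D c` under every exterior, then the ground states of the whole region `regionEdges w F'` screen
`⋃_{c ∈ F'} deepPlaqs w D c` under every exterior. -/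
theorem groundStatesScreened_region_of_cells {θ m : ℝ} (w : Fin 4 → ℤ → ℤ) (D : ℕ) (F' : Finset (Fin 4 → ℤ))
    (h : ∀ c ∈ F', ∀ η : LGConfig 4 G, GroundStatesScreened ρ θ m (regionEdges w {c}) (deepPlaqs w D c) η)
    (ζ : LGConfig 4 G) : GroundStatesScreened ρ θ m (regionEdges w F') (F'.biUnion (deepPlaqs w D)) ζ := by
  classical
  refine groundStatesScreened_biUnion ρ F' (deepPlaqs w D) fun c hc => ?_
  exact groundStatesScreened_of_subregion ρ
    (Finset.biUnion_subset_biUnion_of_subset_left (cellEdges w) (Finset.singleton_subset_iff.2 hc)) (h c hc) ζ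

/-- **Single-cell (Z) ⇒ the `F'`-slice of deep kernel sparseness, every base, eventually (PROVED; no rate).**  For every region `F'` whose
cells' ground states screen their depth-`D` cores (margin `m > 0`) under all exteriors and every `0 < q ≤ 1`: `KernelPlaqSparseDeepOn ρ β w θ
ℓ₀ D q F'` for all `β ≥ β₀(F', q, …)` (p564192's `kernelPlaqSparseDeepOn_of_groundStatesScreened` after §3). -/
theorem kernelPlaqSparseDeepOn_of_cellsScreened (hρ : Continuous ρ) {θ m : ℝ} (hm : 0 < m) (w : Fin 4 → ℤ → ℤ) (ℓ₀ D : ℕ)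
    (F' : Finset (Fin 4 → ℤ))
    (h : ∀ c ∈ F', ∀ η : LGConfig 4 G, GroundStatesScreened ρ θ m (regionEdges w {c}) (deepPlaqs w D c) η)
    {q : ℝ} (hq0 : 0 < q) (hq1 : q ≤ 1) :
    ∃ β₀ : ℝ, ∀ β : ℝ, β₀ ≤ β → KernelPlaqSparseDeepOn ρ β w θ ℓ₀ D q F' :=
  kernelPlaqSparseDeepOn_of_groundStatesScreened ρ hρ hm w ℓ₀ D F' (groundStatesScreened_region_of_cells ρ w D F' h) hq0 hq1

/-- **Single-cell (Z) ⇒ the `F'`-slice of clause (ii) for `TypChainDeep`, every budget, eventually (PROVED; fixed mesh-`b` frame, no rate):**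
the zero-temperature input of every slice of conjunct (ii) for the deep class is a statement about ONE cell and its exteriors. -/
theorem clauseIIukpOn_typChainDeep_of_cellsScreened (hρ : Continuous ρ) {θ m : ℝ} (hm : 0 < m) {b : ℕ} {w : Fin 4 → ℤ → ℤ}
    (hw : IsFrame b w) (ℓ₀ D : ℕ) (F' : Finset (Fin 4 → ℤ))
    (h : ∀ c ∈ F', ∀ η : LGConfig 4 G, GroundStatesScreened ρ θ m (regionEdges w {c}) (deepPlaqs w D c) η)
    {δ : ℝ} (hδ : 0 < δ) :
    ∃ β₀ : ℝ, ∀ β : ℝ, β₀ ≤ β → ClauseIIukpOn ρ β w δ (TypChainDeep ρ θ w ℓ₀ D) F' :=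
  clauseIIukpOn_typChainDeep_of_groundStatesScreened ρ hρ hm hw ℓ₀ D F' (groundStatesScreened_region_of_cells ρ w D F' h) hδ

end CellLocal

/-! ## §4 The zero-temperature energy budget: forcing is a boundary-size effect -/
section Budget

variable {G : Type} [Group G] {N : ℕ} (ρ : G →* Matrix (Fin N) (Fin N) ℂ)

/-- A plaquette whose four links lie in `Λ` is FLAT in the flat-interior configuration `1 ζ_{Λᶜ}`, whatever the exterior. -/
theorem plaqAction_glueWith_one_of_subset {Λ : Finset (ZdEdge 4)} {p : ZdPlaquette 4} (hp : plaquetteEdges p ⊆ Λ)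
    (ζ : LGConfig 4 G) : plaqAction ρ p (glueWith Λ (fun _ : ↥Λ => (1 : G)) ζ) = 0 := by
  rw [← plaqAction_one ρ p]
  exact plaqAction_congr ρ p fun e he => by rw [glueWith_apply_mem _ _ _ (hp he)]; rfl

/-- **Ground-state energy ≤ the straddling budget (PROVED):** a ground state's interior energy is at most the energy of the FLAT
interior `1 ζ_{Λᶜ}`, whose own plaquettes (links inside `Λ`) cost nothing and whose straddling plaquettes cost `≤ 2N` each
(unitary `ρ`): `S_Λ(x ζ_{Λᶜ}) ≤ 2N · #{p touching Λ, not inside Λ}` — for a mesh-`b` cell `O(b³)` against `Θ(b⁴)` own plaquettes. -/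
theorem interiorEnergy_le_of_isGroundState (hρu : ∀ g, ρ g ∈ Matrix.unitaryGroup (Fin N) ℂ) {Λ : Finset (ZdEdge 4)}
    {ζ : LGConfig 4 G} {x : ↥Λ → G} (hx : IsGroundState ρ Λ ζ x) :
    interiorEnergy ρ Λ ζ x ≤ 2 * N * (((plaquettesTouching Λ).filter fun p => ¬ plaquetteEdges p ⊆ Λ).card : ℝ) := by
  classical
  refine (hx fun _ => 1).trans ?_
  unfold interiorEnergy
  rw [wilsonBoundaryAction_eq_sum_plaqAction,
    ← Finset.sum_filter_add_sum_filter_not (plaquettesTouching Λ) (fun p => plaquetteEdges p ⊆ Λ)]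
  have h0 : ∑ p ∈ (plaquettesTouching Λ).filter (fun p => plaquetteEdges p ⊆ Λ),
      plaqAction ρ p (glueWith Λ (fun _ : ↥Λ => (1 : G)) ζ) = 0 :=
    Finset.sum_eq_zero fun p hp => plaqAction_glueWith_one_of_subset ρ (Finset.mem_filter.1 hp).2 ζ
  rw [h0, zero_add]
  calc ∑ p ∈ (plaquettesTouching Λ).filter (fun p => ¬ plaquetteEdges p ⊆ Λ), plaqAction ρ p (glueWith Λ (fun _ : ↥Λ => (1 : G)) ζ)
      ≤ ∑ p ∈ (plaquettesTouching Λ).filter (fun p => ¬ plaquetteEdges p ⊆ Λ), (2 * N : ℝ) :=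
        Finset.sum_le_sum fun p _ => plaqAction_le_two_mul ρ hρu p _
    _ = 2 * N * (((plaquettesTouching Λ).filter fun p => ¬ plaquetteEdges p ⊆ Λ).card : ℝ) := by
        rw [Finset.sum_const, nsmul_eq_mul]; ring

/-- **The own action of a ground state is at most the straddling budget (PROVED)** (drop the nonnegative straddling terms). -/
theorem sum_own_plaqAction_le_of_isGroundState (hρu : ∀ g, ρ g ∈ Matrix.unitaryGroup (Fin N) ℂ) {Λ : Finset (ZdEdge 4)}
    {ζ : LGConfig 4 G} {x : ↥Λ → G} (hx : IsGroundState ρ Λ ζ x) :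
    ∑ p ∈ (plaquettesTouching Λ).filter (fun p => plaquetteEdges p ⊆ Λ), plaqAction ρ p (glueWith Λ x ζ) ≤
      2 * N * (((plaquettesTouching Λ).filter fun p => ¬ plaquetteEdges p ⊆ Λ).card : ℝ) := by
  have htot := interiorEnergy_le_of_isGroundState ρ hρu hx
  unfold interiorEnergy at htot
  rw [wilsonBoundaryAction_eq_sum_plaqAction] at htot
  exact (Finset.sum_le_sum_of_subset_of_nonneg (Finset.filter_subset _ _)
    fun p _ _ => plaqAction_nonneg ρ hρu p _).trans htot

/-- **Forced plaquettes are few (PROVED; Markov count at zero temperature):** in any ground state, under any exterior, the number of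
own plaquettes of action `≥ θ'` (`θ' > 0`) is at most `2N · #straddling / θ'`.  Consequence for the hypotheses of this seat's files:
`GroundStatesForce`∕`GroundStatesChainedDeep` can charge at most a boundary-size worth of plaquettes of any region — they cannot fill a
core; (Z) can fail in a ground state on at most that many plaquettes. -/
theorem card_bad_own_mul_le_of_isGroundState (hρu : ∀ g, ρ g ∈ Matrix.unitaryGroup (Fin N) ℂ) {Λ : Finset (ZdEdge 4)}
    {ζ : LGConfig 4 G} {x : ↥Λ → G} (hx : IsGroundState ρ Λ ζ x) {θ' : ℝ} (hθ' : 0 ≤ θ') :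
    θ' * (((plaquettesTouching Λ).filter fun p => plaquetteEdges p ⊆ Λ ∧ θ' ≤ plaqAction ρ p (glueWith Λ x ζ)).card : ℝ) ≤
      2 * N * (((plaquettesTouching Λ).filter fun p => ¬ plaquetteEdges p ⊆ Λ).card : ℝ) := by
  classical
  have h1 : θ' * (((plaquettesTouching Λ).filter fun p => plaquetteEdges p ⊆ Λ ∧ θ' ≤ plaqAction ρ p (glueWith Λ x ζ)).card : ℝ)
      = ∑ p ∈ (plaquettesTouching Λ).filter (fun p => plaquetteEdges p ⊆ Λ ∧ θ' ≤ plaqAction ρ p (glueWith Λ x ζ)), θ' := by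
    rw [Finset.sum_const, nsmul_eq_mul, mul_comm]
  have h2 : ∑ p ∈ (plaquettesTouching Λ).filter (fun p => plaquetteEdges p ⊆ Λ ∧ θ' ≤ plaqAction ρ p (glueWith Λ x ζ)), θ' ≤
      ∑ p ∈ (plaquettesTouching Λ).filter (fun p => plaquetteEdges p ⊆ Λ ∧ θ' ≤ plaqAction ρ p (glueWith Λ x ζ)),
        plaqAction ρ p (glueWith Λ x ζ) :=
    Finset.sum_le_sum fun p hp => (Finset.mem_filter.1 hp).2.2
  have h3 : ∑ p ∈ (plaquettesTouching Λ).filter (fun p => plaquetteEdges p ⊆ Λ ∧ θ' ≤ plaqAction ρ p (glueWith Λ x ζ)),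
        plaqAction ρ p (glueWith Λ x ζ) ≤
      ∑ p ∈ (plaquettesTouching Λ).filter (fun p => plaquetteEdges p ⊆ Λ), plaqAction ρ p (glueWith Λ x ζ) :=
    Finset.sum_le_sum_of_subset_of_nonneg
      (fun p hp => Finset.mem_filter.2 ⟨(Finset.mem_filter.1 hp).1, (Finset.mem_filter.1 hp).2.1⟩)
      fun p _ _ => plaqAction_nonneg ρ hρu p _
  have _ := hθ'
  linarith [sum_own_plaqAction_le_of_isGroundState ρ hρu hx]

/-- The cell's own plaquettes `cellPlaqs w c` are own plaquettes of the cell's link set in the above sense. -/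
theorem cellPlaqs_subset_filter (w : Fin 4 → ℤ → ℤ) (c : Fin 4 → ℤ) :
    cellPlaqs w c ⊆ (plaquettesTouching (cellEdges w c)).filter fun p => plaquetteEdges p ⊆ cellEdges w c := by
  intro q hq
  have hsub := plaquetteEdges_subset_of_mem_cellPlaqs hq
  refine Finset.mem_filter.2 ⟨mem_plaquettesTouching_iff.2 ⟨(q.1, q.2.1.1), Finset.mem_inter.2 ⟨base_mem_plaquetteEdges q,
    hsub (base_mem_plaquetteEdges q)⟩⟩, hsub⟩

end Budget

end Summit.QuantumFields.YangMills.Cruxes.IR.AfPincerUc.SharpLanes.GroundStateLocality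

end
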